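import Literature.AnabelianGeometry.SemiGraphs.CosetCategoriesFSM
import Literature.AnabelianGeometry.SemiGraphs.CosetCategoriesBridge
import Literature.AlgebraicGeometry.Frobenioids.QuasiTemperoidGaloisBase
import HarnessLib

/-!
# The small model `RelCosetCat Π°` of `𝓑^temp(Π, Π°)⁰` ([FrdII] Ex. 1.3 (i), (iii))

Mochizuki, *The geometry of Frobenioids II*, Kyushu J. Math. **62** (2008) 401–460, §1 Example 1.3 (i), author's
text p. 11 [cite: MochizukiFrdII2008, Ex 1.3 (i) p.11]: "If `Π` is a tempered topological group, and `Π° ⊆ Π` is an open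
subgroup, then … `𝓑^temp(Π, Π°) ⊆ 𝓑^temp(Π)` [is] the full subcategory determined by the objects that admit a morphism
to the object `Π/Π°`. … if `𝓔 = 𝓑^temp(Π, Π°)`, then `𝓔⁰` is a connected, totally epimorphic category, which is of
FSM-type [indeed, every monomorphism of `𝓔⁰` is an isomorphism], hence, in particular, of FSMFF-type"; and (iii)
p. 12 [cite: MochizukiFrdII2008, Ex 1.3 (iii) pp.11-12]: "when `F = ℚ_p`, if we set `D := 𝓑^temp(Π, Π°)⁰`, then we
obtain a functor `D → D₀ = 𝓑^temp(G_{ℚ_p})⁰` [cf. Example 1.1, (ii)] which satisfies the hypotheses of Theorem 1.2, (i)."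

WHY THIS FILE. The tree's `𝓑^temp(Π, Π°)⁰` is `ConnectedPart (QuasiTemperoid.BTempRel Π Π°)` (abc-iut-L1-t4, objects in
`Type (u+1)`), one universe above the `p`-adic valued fields of `PadicFrd.PadicFld.{u}`, so it cannot serve as the base
`D ⥤ PadicFld p` of a `PadicFrd.Datum` (the kernel form of Theorem 1.2 / Example 1.1 (ii)). For `Π° = Π` the tree already
uses abc-iut-L5-t2's SMALL coset model `CosetCat Π` (`CosetCategories.lean`, `CosetCat Π ≌ ConnectedPart (BTemp Π)`). This
file provides the RELATIVE small model, word for word print's definition: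

* `CosetCat.admitsHomTo Π°` — "objects that admit a morphism to `Π/Π°`" (an object `Π/U` does iff `U` lies in a
  conjugate of `Π°`, `admitsHomTo_iff`), stable under passing to the source of a morphism (`admitsHomTo_of_hom`);
* `RelCosetCat Π° := (CosetCat.admitsHomTo Π°).FullSubcategory` — the small `𝓑^temp(Π, Π°)⁰`, with its distinguished
  object `RelCosetCat.coset Π°` (`= Π/Π°`) and the inclusion `RelCosetCat.incl : RelCosetCat Π° ⥤ CosetCat Π`;
* the printed standing properties: `RelCosetCat.isConnected`, `isTotallyEpimorphic`, `isOfFSMType` ("every monomorphism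
  is an isomorphism", `isIso_of_mono`), `isOfFSMFFType`; and slimness INHERITED from `CosetCat Π` (`isSlim_of_isSlim`; a
  full subcategory closed under sources of morphisms has the same slices);
* the comparison `RelCosetCat.toRelConnected : RelCosetCat Π° ⥤ ConnectedPart (BTempRel Π Π°)`, `U ↦ Π/U`, FULL, FAITHFUL
  and ESSENTIALLY SURJECTIVE (`Π` tempered), i.e. an equivalence `RelCosetCat.equivRelConnectedPart` — the small model IS
  the tree's `𝓑^temp(Π, Π°)⁰` up to equivalence.
The `ℚ_p`-base functor of (iii) over this model and the Datum-level consequences live in abc-iut-L1-t4's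
`PadicFrobenioidRelCosetBase.lean`. Pure topological-group / category theory over Mathlib and landed files; nothing of
the disputed series is asserted; no statement of the paper is strengthened.
-/

namespace Literature.AnabelianGeometry.SemiGraphs

open CategoryTheory Literature.AlgebraicGeometry.Frobenioids
open Literature.AlgebraicGeometry.Frobenioids.QuasiTemperoid

universe u

variable {G : Type u} [Group G] [TopologicalSpace G]

namespace CosetCat

/-- "objects that admit a morphism to the object `Π/Π°`" (FrdII Ex. 1.3 (i) p. 11), as a property of objects `Π/U`
of the small coset category. [cite: MochizukiFrdII2008, Ex 1.3 (i) p.11] -/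
def admitsHomTo (H : OpenSubgroup G) : ObjectProperty (CosetCat G) := fun X => Nonempty (X ⟶ (⟨H⟩ : CosetCat G))

/-- `Π/U` admits a morphism to `Π/Π°` iff `U` lies in a conjugate of `Π°` (`U ⊆ g Π° g⁻¹`, the point `g·Π°` being the
image of `1·U`). [cite: MochizukiFrdII2008, Ex 1.3 (i) p.11] -/
theorem admitsHomTo_iff (H : OpenSubgroup G) (X : CosetCat G) :
    admitsHomTo H X ↔ ∃ g : G, ∀ u ∈ X.sg, g⁻¹ * u * g ∈ H := by
  constructor
  · rintro ⟨f⟩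
    obtain ⟨g, hg⟩ := QuotientGroup.mk_surjective (pt f)
    exact ⟨g, fun u hu => (smul_coe_eq_coe_iff (⟨H⟩ : CosetCat G) u g).mp (by rw [hg]; exact smul_pt f hu)⟩
  · rintro ⟨g, hg⟩
    exact ⟨homMk ((g : G) : (⟨H⟩ : CosetCat G).carrier) fun u hu => (smul_coe_eq_coe_iff _ u g).mpr (hg u hu)⟩

/-- The property is inherited along morphisms: if `Π/V` admits a morphism to `Π/Π°`, so does any `Π/U → Π/V`.
[cite: MochizukiFrdII2008, Ex 1.3 (i) p.11] -/
theorem admitsHomTo_of_hom (H : OpenSubgroup G) {X Y : CosetCat G} (f : X ⟶ Y) (hY : admitsHomTo H Y) :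
    admitsHomTo H X :=
  ⟨f ≫ hY.some⟩

/-- `Π/Π°` itself admits a morphism to `Π/Π°`. [cite: MochizukiFrdII2008, Ex 1.3 (i) p.11] -/
theorem admitsHomTo_self (H : OpenSubgroup G) : admitsHomTo H (⟨H⟩ : CosetCat G) := ⟨𝟙 _⟩

/-- `Π/U` with `U ⊆ Π°` admits the projection `Π/U → Π/Π°`. [cite: MochizukiFrdII2008, Ex 1.3 (i) p.11] -/
theorem admitsHomTo_of_le (H : OpenSubgroup G) {X : CosetCat G} (h : X.sg ≤ H) : admitsHomTo H X :=
  (admitsHomTo_iff H X).mpr ⟨1, fun u hu => by rw [inv_one, one_mul, mul_one]; exact h hu⟩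

end CosetCat

/-- **`𝓑^temp(Π, Π°)⁰`, small model**: the full subcategory of the coset category `CosetCat Π` (= `𝓑^temp(Π)⁰`) on the
objects `Π/U` "that admit a morphism to the object `Π/Π°`" (FrdII Ex. 1.3 (i) p. 11). [cite: MochizukiFrdII2008, Ex 1.3 (i) p.11] -/
abbrev RelCosetCat (H : OpenSubgroup G) : Type u := (CosetCat.admitsHomTo H).FullSubcategory

namespace RelCosetCat

variable (H : OpenSubgroup G)

/-- The inclusion `𝓑^temp(Π, Π°)⁰ ↪ 𝓑^temp(Π)⁰` (the first arrow of Ex. 1.3 (iii)), small models.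
[cite: MochizukiFrdII2008, Ex 1.3 (iii) pp.11-12] -/
abbrev incl : RelCosetCat H ⥤ CosetCat G := (CosetCat.admitsHomTo H).ι

/-- The distinguished object `Π/Π°` of `𝓑^temp(Π, Π°)⁰`. [cite: MochizukiFrdII2008, Ex 1.3 (i) p.11] -/
def coset : RelCosetCat H := ⟨⟨H⟩, CosetCat.admitsHomTo_self H⟩

variable {H}

/-- An object of `CosetCat Π` mapping to an object of `𝓑^temp(Π, Π°)⁰` is itself in `𝓑^temp(Π, Π°)⁰`.
[cite: MochizukiFrdII2008, Ex 1.3 (i) p.11] -/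
def ofHom {X : CosetCat G} {Y : RelCosetCat H} (f : X ⟶ Y.obj) : RelCosetCat H :=
  ⟨X, CosetCat.admitsHomTo_of_hom H f Y.property⟩

/-- The structure morphism of `ofHom f` (namely `f`). [cite: MochizukiFrdII2008, Ex 1.3 (i) p.11] -/
def ofHomHom {X : CosetCat G} {Y : RelCosetCat H} (f : X ⟶ Y.obj) : ofHom f ⟶ Y := ObjectProperty.homMk f

/-- Every object maps to `Π/Π°`. [cite: MochizukiFrdII2008, Ex 1.3 (i) p.11] -/
theorem nonempty_hom_coset (X : RelCosetCat H) : Nonempty (X ⟶ coset H) :=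
  ⟨ObjectProperty.homMk X.property.some⟩

/-! ### Connected, totally epimorphic, FSM-type ("`𝓔⁰` is a connected, totally epimorphic category … of FSM-type") -/

variable (H) in
/-- "`𝓔⁰` is a connected … category" (every object maps to `Π/Π°`). [cite: MochizukiFrdII2008, Ex 1.3 (i) p.11] -/
theorem isConnected : IsConnected (RelCosetCat H) := by
  haveI : Nonempty (RelCosetCat H) := ⟨coset H⟩
  exact zigzag_isConnected fun X Y => Zigzag.of_hom_inv (nonempty_hom_coset X).some (nonempty_hom_coset Y).some

variable (H) in
/-- "`𝓔⁰` is a … totally epimorphic category" (an epimorphism of `CosetCat Π` stays epi in the full subcategory).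
[cite: MochizukiFrdII2008, Ex 1.3 (i) p.11] -/
theorem isTotallyEpimorphic : Literature.AlgebraicGeometry.Frobenioids.IsTotallyEpimorphic (RelCosetCat H) := by
  refine ⟨fun {X Y} f => ⟨fun {Z} g h w => ?_⟩⟩
  haveI := CosetCat.isTotallyEpimorphic.epi f.hom
  apply ObjectProperty.hom_ext
  have w' := congrArg InducedCategory.Hom.hom w
  exact (cancel_epi f.hom).mp w'

/-- Morphisms of `𝓑^temp(Π, Π°)⁰` are surjective on cosets. [cite: MochizukiFrdII2008, Ex 1.3 (i) p.11] -/
theorem hom_surjective {X Y : RelCosetCat H} (f : X ⟶ Y) : Function.Surjective (CosetCat.Hom.toFun f.hom) :=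
  CosetCat.toFun_surjective f.hom

/-- **A monomorphism of `𝓑^temp(Π, Π°)⁰` is injective** (topological group `Π`): two cosets `aU`, `a'U` with the same
image give two morphisms `Π/W → Π/U` with `W = U ∩ aUa⁻¹ ∩ a'Ua'⁻¹` — an object of the subcategory since `W ⊆ U` —
equalised by the monomorphism. [cite: MochizukiFrdII2008, Ex 1.3 (i) p.11] -/
theorem hom_injective_of_mono [IsTopologicalGroup G] {X Y : RelCosetCat H} (f : X ⟶ Y) [Mono f] :
    Function.Injective (CosetCat.Hom.toFun f.hom) := by
  intro x x' h
  obtain ⟨a, rfl⟩ := QuotientGroup.mk_surjective x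
  obtain ⟨a', rfl⟩ := QuotientGroup.mk_surjective x'
  obtain ⟨W, hW⟩ := CosetCat.exists_openSubgroup_smul_coe_eq X.obj a
  obtain ⟨W', hW'⟩ := CosetCat.exists_openSubgroup_smul_coe_eq X.obj a'
  let Z₀ : CosetCat G := ⟨X.obj.sg ⊓ (W ⊓ W')⟩
  have hZ : ∀ u ∈ Z₀.sg, u • ((a : G) : X.obj.carrier) = (a : X.obj.carrier) := fun u hu =>
    hW u (OpenSubgroup.mem_inf.mp (OpenSubgroup.mem_inf.mp hu).2).1
  have hZ' : ∀ u ∈ Z₀.sg, u • ((a' : G) : X.obj.carrier) = (a' : X.obj.carrier) := fun u hu =>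
    hW' u (OpenSubgroup.mem_inf.mp (OpenSubgroup.mem_inf.mp hu).2).2
  -- `Z₀ = Π/W` lies in the subcategory: the projection `Π/W → Π/U` followed by `X`'s structure morphism
  have h1 : ∀ u ∈ Z₀.sg, u • ((1 : G) : X.obj.carrier) = ((1 : G) : X.obj.carrier) := fun u hu =>
    (CosetCat.smul_one_eq_one_iff X.obj u).mpr (OpenSubgroup.mem_inf.mp hu).1
  let Z : RelCosetCat H := ofHom (Y := X) (CosetCat.homMk (X := Z₀) (Y := X.obj) ((1 : G) : X.obj.carrier) h1)
  let k : Z ⟶ X := ObjectProperty.homMk (CosetCat.homMk (X := Z₀) (Y := X.obj) ((a : G) : X.obj.carrier) hZ)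
  let k' : Z ⟶ X := ObjectProperty.homMk (CosetCat.homMk (X := Z₀) (Y := X.obj) ((a' : G) : X.obj.carrier) hZ')
  have hcomp : k ≫ f = k' ≫ f := ObjectProperty.hom_ext _ (CosetCat.hom_ext (by
    change CosetCat.pt (CosetCat.homMk _ hZ ≫ f.hom) = CosetCat.pt (CosetCat.homMk _ hZ' ≫ f.hom)
    rw [CosetCat.pt_comp, CosetCat.pt_comp, CosetCat.pt_homMk, CosetCat.pt_homMk]
    exact h))
  have heq := congrArg (fun g : Z ⟶ X => CosetCat.pt g.hom) ((cancel_mono f).mp hcomp)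
  change CosetCat.pt (CosetCat.homMk _ hZ) = CosetCat.pt (CosetCat.homMk _ hZ') at heq
  rwa [CosetCat.pt_homMk, CosetCat.pt_homMk] at heq

/-- "[indeed, every monomorphism of `𝓔⁰` is an isomorphism]" (FrdII Ex. 1.3 (i) p. 11), small model.
[cite: MochizukiFrdII2008, Ex 1.3 (i) p.11] -/
theorem isIso_of_mono [IsTopologicalGroup G] {X Y : RelCosetCat H} (f : X ⟶ Y) [Mono f] : IsIso f := by
  haveI : IsIso f.hom := CosetCat.isIso_of_bijective f.hom ⟨hom_injective_of_mono f, hom_surjective f⟩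
  haveI : IsIso ((incl H).map f) := by change IsIso f.hom; infer_instance
  exact isIso_of_fully_faithful (incl H) f

variable (H) in
/-- "`𝓔⁰` … is of FSM-type" (FrdII Ex. 1.3 (i) p. 11), small model. [cite: MochizukiFrdII2008, Ex 1.3 (i) p.11] -/
theorem isOfFSMType [IsTopologicalGroup G] : IsOfFSMType (RelCosetCat H) :=
  ⟨fun f hf => by
    haveI := hf.2
    exact isIso_of_mono f⟩

variable (H) in
/-- "hence, in particular, of FSMFF-type" (FrdII Ex. 1.3 (i) p. 11). [cite: MochizukiFrdII2008, Ex 1.3 (i) p.11] -/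
theorem isOfFSMFFType [IsTopologicalGroup G] : IsOfFSMFFType (RelCosetCat H) :=
  (isOfFSMType H).isOfFSMFFType

/-! ### Slimness is inherited from `CosetCat Π` (the subcategory is closed under sources of morphisms) -/

variable (H) in
/-- **`𝓑^temp(Π, Π°)⁰` is slim whenever `𝓑^temp(Π)⁰` is** ([FrdI] §0 p. 14: all `𝓔⁰_A → 𝓔⁰` rigid): the slice of the
full subcategory over `A` has the same objects and morphisms as the slice of `CosetCat Π` over `A` (every `Π/V → A`
puts `Π/V` in the subcategory), so an automorphism of `(RelCosetCat Π°)_A → RelCosetCat Π°` induces one of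
`(CosetCat Π)_A → CosetCat Π` with the same components. [cite: MochizukiFrdI2008, §0 p.14] -/
theorem isSlim_of_isSlim (h : IsSlim (CosetCat G)) : IsSlim (RelCosetCat H) := by
  refine ⟨fun A α => Iso.ext (NatTrans.ext (funext fun X => ?_))⟩
  rw [Iso.refl_hom, NatTrans.id_app]
  -- transport `α` to an automorphism `β` of `Over.forget A.obj` in `CosetCat Π`
  let lift : Over A.obj → Over A := fun O => Over.mk (ofHomHom (Y := A) O.hom)
  let liftMap : ∀ {O₁ O₂ : Over A.obj} (k : O₁ ⟶ O₂), lift O₁ ⟶ lift O₂ := fun {O₁ O₂} k =>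
    Over.homMk (ObjectProperty.homMk k.left) (ObjectProperty.hom_ext _ (Over.w k))
  have hnat : ∀ {O₁ O₂ : Over A.obj} (k : O₁ ⟶ O₂),
      k.left ≫ (α.hom.app (lift O₂)).hom = (α.hom.app (lift O₁)).hom ≫ k.left := fun k => by
    have h2 := congrArg InducedCategory.Hom.hom (α.hom.naturality (liftMap k))
    exact h2
  have hnat' : ∀ {O₁ O₂ : Over A.obj} (k : O₁ ⟶ O₂),
      k.left ≫ (α.inv.app (lift O₂)).hom = (α.inv.app (lift O₁)).hom ≫ k.left := fun k => by
    have h2 := congrArg InducedCategory.Hom.hom (α.inv.naturality (liftMap k))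
    exact h2
  let β : Over.forget A.obj ≅ Over.forget A.obj :=
    { hom := { app := fun O => (α.hom.app (lift O)).hom, naturality := fun O₁ O₂ k => hnat k }
      inv := { app := fun O => (α.inv.app (lift O)).hom, naturality := fun O₁ O₂ k => hnat' k }
      hom_inv_id := by
        ext O
        change (α.hom.app (lift O)).hom ≫ (α.inv.app (lift O)).hom = 𝟙 _
        rw [← ObjectProperty.FullSubcategory.comp_hom, ← NatTrans.comp_app, Iso.hom_inv_id, NatTrans.id_app]
        rfl
      inv_hom_id := by
        ext O
        change (α.inv.app (lift O)).hom ≫ (α.hom.app (lift O)).hom = 𝟙 _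
        rw [← ObjectProperty.FullSubcategory.comp_hom, ← NatTrans.comp_app, Iso.inv_hom_id, NatTrans.id_app]
        rfl }
  have hβ := h.isRigid_forget A.obj β
  -- the given `X : Over A` IS (definitionally) `lift` of its image in `Over A.obj`
  let O : Over A.obj := Over.mk X.hom.hom
  have hcomp : (α.hom.app (lift O)).hom = 𝟙 _ := by
    have := congrArg (fun γ : Over.forget A.obj ≅ Over.forget A.obj => γ.hom.app O) hβ
    change (α.hom.app (lift O)).hom = (Iso.refl (Over.forget A.obj)).hom.app O at this
    rw [this, Iso.refl_hom, NatTrans.id_app]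
    rfl
  apply ObjectProperty.hom_ext
  exact hcomp

/-! ### Comparison with the tree's `𝓑^temp(Π, Π°)⁰ = ConnectedPart (BTempRel Π Π°)` -/

section Comparison

variable [IsTopologicalGroup G] (hG : IsTempered G)

/-- `Π/U` (for `U` in the subcategory) as an object of `𝓑^temp(Π, Π°)`: it admits a morphism to the `Π`-set `Π/Π°`
(the image of a morphism `Π/U → Π/Π°` under L5-t2's `CosetCat.toBTemp`). [cite: MochizukiFrdII2008, Ex 1.3 (i) p.11] -/
def toBTempRel (X : RelCosetCat H) : BTempRel G H.toSubgroup :=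
  ⟨(CosetCat.toBTemp hG).obj X.obj, ⟨((CosetCat.toBTemp hG).map X.property.some).hom⟩⟩

/-- `toBTempRel X` is connected in `𝓑^temp(Π, Π°)` (a single orbit; abc-iut-L1's `BTempRel.isConnectedObj_of_transitive`).
[cite: MochizukiFrdII2008, Ex 1.3 (i) p.11] -/
theorem isConnectedObj_toBTempRel (X : RelCosetCat H) : IsConnectedObj (toBTempRel hG X) :=
  BTempRel.isConnectedObj_of_transitive _ ((1 : G) : X.obj.carrier) (CosetCat.exists_smul_one_eq X.obj)

/-- **`RelCosetCat Π° → ConnectedPart (BTempRel Π Π°)`, `Π/U ↦ Π/U`** — the comparison of the small model with the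
tree's `𝓑^temp(Π, Π°)⁰`. [cite: MochizukiFrdII2008, Ex 1.3 (i) p.11] -/
def toRelConnected : RelCosetCat H ⥤ ConnectedPart (BTempRel G H.toSubgroup) where
  obj X := ⟨toBTempRel hG X, isConnectedObj_toBTempRel hG X⟩
  map f := ObjectProperty.homMk (ObjectProperty.homMk ((CosetCat.toBTemp hG).map f.hom))
  map_id X := by
    apply ObjectProperty.hom_ext; apply ObjectProperty.hom_ext
    change (CosetCat.toBTemp hG).map (𝟙 X.obj) = 𝟙 ((CosetCat.toBTemp hG).obj X.obj)
    exact (CosetCat.toBTemp hG).map_id _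
  map_comp f g := by
    apply ObjectProperty.hom_ext; apply ObjectProperty.hom_ext
    change (CosetCat.toBTemp hG).map (f.hom ≫ g.hom) = (CosetCat.toBTemp hG).map f.hom ≫ (CosetCat.toBTemp hG).map g.hom
    exact (CosetCat.toBTemp hG).map_comp _ _

/-- `toRelConnected` is faithful. [cite: MochizukiFrdII2008, Ex 1.3 (i) p.11] -/
theorem toRelConnected_faithful : (toRelConnected (H := H) hG).Faithful where
  map_injective {X Y} f f' h := by
    apply ObjectProperty.hom_ext
    have h1 := congrArg (fun k => InducedCategory.Hom.hom (InducedCategory.Hom.hom k)) h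
    exact (CosetCat.toBTemp_faithful hG).map_injective h1

/-- `toRelConnected` is full (a morphism of `Π`-sets `Π/U → Π/V` is an equivariant map). [cite: MochizukiFrdII2008, Ex 1.3 (i) p.11] -/
theorem toRelConnected_full : (toRelConnected (H := H) hG).Full where
  map_surjective {X Y} k := by
    obtain ⟨f, hf⟩ := (CosetCat.toBTemp_full hG).map_surjective k.hom.hom
    exact ⟨ObjectProperty.homMk f, by
      apply ObjectProperty.hom_ext; apply ObjectProperty.hom_ext
      exact hf⟩

/-- `toRelConnected` is essentially surjective: a connected object `T` of `𝓑^temp(Π, Π°)` is a single orbit, hence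
`≅ Π/Stab(x₀)` in `𝓑^temp(Π)` (L5-t2's `CosetCat.nonempty_iso_toBTemp`), and `Π/Stab(x₀)` admits a morphism to `Π/Π°`
(compose with `T → Π/Π°`). [cite: MochizukiFrdII2008, Ex 1.3 (i) p.11] -/
theorem toRelConnected_essSurj : (toRelConnected (H := H) hG).EssSurj where
  mem_essImage T := by
    have hT : IsConnectedObj T.obj.obj := isConnectedObj_obj_of_rel G H.toSubgroup T.obj T.property
    obtain ⟨x₀⟩ := BTempConnected.nonempty_of_isConnectedObj T.obj.obj hT
    obtain ⟨e⟩ := CosetCat.nonempty_iso_toBTemp hG T.obj.obj hT x₀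
    -- the coset object `Π/Stab(x₀)` admits a morphism to `Π/Π°`: `Π/Stab(x₀) ≅ T → Π/Π°`, pulled back along `toBTemp` (full)
    obtain ⟨k⟩ := T.obj.property
    haveI := CosetCat.toBTemp_full hG
    let k' : (CosetCat.toBTemp hG).obj (CosetCat.stabObj T.obj.obj x₀) ⟶ (CosetCat.toBTemp hG).obj ⟨H⟩ :=
      e.hom ≫ ObjectProperty.homMk k
    let X : RelCosetCat H := ⟨CosetCat.stabObj T.obj.obj x₀, ⟨(CosetCat.toBTemp hG).preimage k'⟩⟩
    exact ⟨X, ⟨(connectedObjects (BTempRel G H.toSubgroup)).isoMk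
      ((admitsHomToCoset G H.toSubgroup).isoMk e)⟩⟩

/-- `toRelConnected` is an equivalence of categories. [cite: MochizukiFrdII2008, Ex 1.3 (i) p.11] -/
theorem toRelConnected_isEquivalence : (toRelConnected (H := H) hG).IsEquivalence :=
  { faithful := toRelConnected_faithful hG, full := toRelConnected_full hG, essSurj := toRelConnected_essSurj hG }

/-- **`RelCosetCat Π° ≌ 𝓑^temp(Π, Π°)⁰`** (`Π` tempered): the small model is the tree's category of connected objects
of `𝓑^temp(Π, Π°)` up to equivalence, so every statement of [FrdII] §1–§2 over `D = 𝓑^temp(Π, Π°)⁰` transports.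
[cite: MochizukiFrdII2008, Ex 1.3 (i) p.11] -/
noncomputable def equivRelConnectedPart : RelCosetCat H ≌ ConnectedPart (BTempRel G H.toSubgroup) :=
  haveI := toRelConnected_isEquivalence (H := H) hG
  (toRelConnected hG).asEquivalence

end Comparison

end RelCosetCat

end Literature.AnabelianGeometry.SemiGraphs
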